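import Literature.MathematicalPhysics.QuantumFieldTheory.Balaban1983to89.B1Eq324BenfattoSect5JointCumulants
import Literature.MathematicalPhysics.QuantumFieldTheory.Balaban1983to89.B1Eq324WeightedCumulantLeaf
import HarnessLib

/-!
# `Balaban1983to89.B1Eq324BenfattoSect5ChiToOne` — [BenfattoEtAl1978] §5 p. 158, the first term of (5.29) «the replacement of
# the χ's by 1» (Appendix D p. 165: «a trivial consequence of point 2) and Lemma 1 of Appendix C»), in the MOMENT form that
# covers print's unbounded polynomial slots: `|𝓔^T(Z₁χ,…,Z_kχ) − 𝓔^T(Z₁,…,Z_k)| ≤ 2^k·A_k·η·L^k` — PROVED (generic rate)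

statement-level skeleton of published theorems with citation tags; proofs where landed; nothing here is a claim about the
Yang–Mills mass gap

WHY THIS MODULE (cell `pub-ymgap`, seat `dag-n08-b`, node N08 «first missing estimate» lane; sequel of
`B1Eq324BenfattoSect5JointCumulants` = (5.25)–(5.26)).  After (5.25)–(5.28), §5 of [BenfattoEtAl1978] bounds the joint
conditional truncated expectations `𝓔^T_{z_{Γ₁}}(Ψ′₁χ, Ψ″₁χ, Ψ₂χ; h₁, h₂, k₂)` by (5.29), *"where the first term comes from the
replacement of the χ's by 1, the second from the properties of the conditioned measure and from the Wick theorem (see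
Appendix D)"* (p. 158); Appendix D (p. 165): *"The replacement of the χ's by 1 is a trivial consequence of point 2) and Lemma 1
of Appendix C."*  The sibling file's §5 (`B1Eq324BenfattoSect5JointCumulants.abs_ursellOf_moment_mul_sub_le`) proved the
replacement for BOUNDED uncut slots `|Z_j| ≤ K`; but in print the uncut `Ψ′₁, Ψ″₁, Ψ₂` are POLYNOMIALS of the conditioned
Gaussian field — only `Ψχ` is bounded (point i) p. 155), the `Ψ` themselves merely have moments of every order (seat's
self-located scope note on the bus).  This module proves the replacement under MOMENT hypotheses, which is the generic
statement print's situation satisfies: slots with `∫|Z_j|^p dP̄ ≤ L^p` (`p ≤ 2k`), a weight `0 ≤ χ ≤ 1` with `P̄(χ ≠ 1) ≤ η^{2k}`.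
The two inputs print names are exactly what is abstracted: «point 2)» (the conditioned measure's centre/covariance, hence
moment bounds `L` for its polynomials — Gaussian, not derived here) and «Lemma 1 of Appendix C» (the tail `P̄(χ ≠ 1)`, here
`η^{2k}`; on print's objects (5.19)/App. C Lemma 2, tree `B1Eq324BenfattoSect5Cumulant.eq519_condField`).

THE PRINTED TEXT (verbatim from the page images `bcg_p157.png`, `bcg_p158.png`, `bcg_p165_s3.png`).  p. 157–158: *"Then the
second term in (5.25) can be written* `Σ_{k₂>0} k!/(k₁!k₂!) 𝓔^T_{z_Γ}(Ψ′₁χ, Ψ₂χ; k₁, k₂) + Σ_{k₂>0, h₁,h₂, h₂>0, h₁+h₂=k−k₂}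
𝓔^T_{z_{Γ₁}}(Ψ′₁χ, Ψ″₁χ, Ψ₂χ; h₁, h₂, k₂)` (5.28) *and the properties of the free field allow to bound the second term of this sum
as* `s₄((s₂b^{D+2d}A)^k e^{−b²/4} + (s₂b^{D+2d}A)^k e^{−ϰ̃b^{3/2}})` (5.29) *where the first term comes from the replacement of
the χ's by 1, the second from the properties of the conditioned measure and from the Wick theorem (see Appendix D) and s_k and
ϰ̃ are positive constants."*  p. 165, Appendix D: *"The replacement of the χ's by 1 is a trivial consequence of point 2) and
Lemma 1 of Appendix C. In order to complete the proof we need to evaluate 𝓔^T₀(Ψ̃′₁, Ψ̃″₁, Ψ̃₂; h₁, h₂, k₂)."*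

DICTIONARY.  As in the sibling: `P̄(dz_□|z_{Γ₁})` ↦ a probability measure `μ`; a joint truncated expectation of the slots
`j ∈ σ` (`|σ| = k`) ↦ `LatticeModels.ursellOf (P ↦ ∫ Π_{j∈P} Z_j dμ) univ`; «the χ's» ↦ one weight `0 ≤ χ ≤ 1` multiplying
every slot (print's `χ = χ_b^□`, the same in all three arguments); the replacement ↦ the difference of the Ursell functions of
`(Z_jχ)_j` and `(Z_j)_j`.

WHAT IS PROVED (theorems only; no definition, no named fact, no `sorry`; axioms standard).
* §1 `abs_integral_prod_le_of_moments` — `|∫ Π_{j∈P} Z_j dμ| ≤ L^{|P|}` from `∫|Z_j|^{|P|} ≤ L^{|P|}` (AM–GM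
  `Π_{j∈P}|Z_j| ≤ |P|⁻¹ Σ_{j∈P}|Z_j|^{|P|}`, no sup bound).
* §2 **`ursellOf_moment_sum_eq_sum_of_moments`** — multilinearity of the joint truncated expectations of product moments under
  MOMENT (integrability) hypotheses (the bounded version is the sibling's `ursellOf_moment_sum_eq_sum`; same engine
  `LatticeModels.ursellOf_piFinset`).
* §3 `abs_integral_prod_mark_le_of_moments` — a product containing a factor `Z_j(1−χ)` is `≤ η^k·L^{|P|}` (Cauchy–Schwarz
  `B1Eq324WeightedCumulantLeaf.abs_integral_mul_le_sqrt_mul_sqrt` against `(1−χ)^a ≤ 1_{χ≠1}`, AM–GM for `∫Π Z_j²`); ★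
  **`abs_ursellOf_moment_mul_sub_le_of_moments`** — THE REPLACEMENT OF THE χ's BY 1:
  `|𝓔^T(Z₁χ,…,Z_kχ) − 𝓔^T(Z₁,…,Z_k)| ≤ 2^k·(Σ_{π∈𝒫(k)}(|π|−1)!)·η·L^k`.

HONEST SCOPE / NOT HERE.  (i) AS PROVED vs AS PRINTED: the rate is `η = P̄(χ ≠ 1)^{1/(2k)}` — with (5.19) this is
`(3b^{2d})^{1/(2k)}e^{−b²/(8k)}`, whereas print's first term of (5.29) carries `e^{−b²/4}`; print extracts it from the Gaussian
structure (the tail enters once, not under a `2k`-th root), which no measure-theoretic argument sees.  Both are dominated by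
the `e^{−ρ₃b^{3/2}}` of (4.6)–(4.7), so the FORM of the Basic Lemma is insensitive to the difference; the constants differ.
(ii) The moment input `∫|Ψ|^p ≤ L^p` for print's polynomials of the conditioned field (Gaussian moments / «point 2)») and the
second term of (5.29) (Wick's theorem, connected diagrams, the damping `e^{−ϰ̃b^{3/2}}` — Appendix D proper) are NOT here;
nor (5.30)–(5.32).  `BasicLemmaPrinted` stays OPEN.  NOT summit progress; count-neutral for N08; nothing of [Balaban1985UV3]
is asserted.
-/

open MeasureTheory ProbabilityTheory Finset
open scoped BigOperators Nat

namespace Literature.MathematicalPhysics.QuantumFieldTheory.Balaban1983to89.B1Eq324BenfattoSect5ChiToOne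

open _root_.MeasureTheory _root_.ProbabilityTheory
open Literature.Probability.LatticeModels
open Literature.MathematicalPhysics.QuantumFieldTheory.Balaban1983to89.B10Eq24Cumulant
open Literature.MathematicalPhysics.QuantumFieldTheory.Balaban1983to89.B1Eq324BenfattoSect5JointCumulants
open Literature.MathematicalPhysics.QuantumFieldTheory.Balaban1983to89.B1Eq324WeightedCumulantLeaf

variable {Ω : Type*} {mΩ : MeasurableSpace Ω} {μ : Measure Ω}
variable {σ : Type*} [Fintype σ] [DecidableEq σ]

/-! ## §1  Joint moments under MOMENT hypotheses (AM–GM in place of sup norms) -/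

section Moments

omit [Fintype σ] [DecidableEq σ] in
/-- AM–GM for a nonempty finite product of non-negative reals: `Π_{j∈P} a_j ≤ |P|⁻¹·Σ_{j∈P} a_j^{|P|}` (weighted AM–GM
`Real.geom_mean_le_arith_mean_weighted` with equal weights at the points `a_j^{|P|}`). [folklore] -/
private theorem prod_le_sum_pow_div {P : Finset σ} (hP : P.Nonempty) (a : σ → ℝ) (ha : ∀ j ∈ P, 0 ≤ a j) :
    ∏ j ∈ P, a j ≤ (∑ j ∈ P, a j ^ P.card) / P.card := by
  have hn : (0 : ℝ) < P.card := Nat.cast_pos.2 hP.card_pos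
  have hw : ∑ j ∈ P, (fun _ : σ => 1 / (P.card : ℝ)) j = 1 := by
    rw [Finset.sum_const, nsmul_eq_mul]
    field_simp
  have h := Real.geom_mean_le_arith_mean_weighted P (fun _ => 1 / (P.card : ℝ)) (fun j => a j ^ P.card)
    (fun _ _ => by positivity) hw (fun j hj => pow_nonneg (ha j hj) _)
  have hL : ∏ j ∈ P, (a j ^ P.card) ^ (1 / (P.card : ℝ)) = ∏ j ∈ P, a j := by
    refine Finset.prod_congr rfl fun j hj => ?_
    rw [one_div, Real.pow_rpow_inv_natCast (ha j hj) hP.card_pos.ne']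
  rw [hL] at h
  calc ∏ j ∈ P, a j ≤ ∑ j ∈ P, 1 / (P.card : ℝ) * a j ^ P.card := h
    _ = (∑ j ∈ P, a j ^ P.card) / P.card := by
        rw [← Finset.mul_sum]
        field_simp

omit [Fintype σ] [DecidableEq σ] in
/-- A product of `|P|` variables each having an integrable `|P|`-th absolute moment is integrable (AM–GM domination).
[folklore] -/
private theorem integrable_prod_of_moments [IsFiniteMeasure μ] {Z : σ → Ω → ℝ} (P : Finset σ)
    (hZm : ∀ j ∈ P, AEStronglyMeasurable (Z j) μ) (hZint : ∀ j ∈ P, Integrable (fun ω => |Z j ω| ^ P.card) μ) :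
    Integrable (fun ω => ∏ j ∈ P, Z j ω) μ := by
  rcases P.eq_empty_or_nonempty with rfl | hP
  · simp only [Finset.prod_empty]
    exact integrable_const _
  have hm : AEStronglyMeasurable (fun ω => ∏ j ∈ P, Z j ω) μ := by
    have h := Finset.aestronglyMeasurable_prod P hZm
    have hfun : (∏ j ∈ P, Z j) = fun ω => ∏ j ∈ P, Z j ω := by
      funext ω
      simp [Finset.prod_apply]
    rwa [hfun] at h
  refine Integrable.mono' ((integrable_finsetSum P fun j hj => hZint j hj).div_const (P.card : ℝ)) hm
    (ae_of_all _ fun ω => ?_)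
  rw [Real.norm_eq_abs, Finset.abs_prod]
  exact prod_le_sum_pow_div hP (fun j => |Z j ω|) fun j _ => abs_nonneg _

omit [Fintype σ] [DecidableEq σ] in
/-- **A joint moment under moment hypotheses**: if `∫|Z_j|^{|P|} dP̄ ≤ L^{|P|}` for `j ∈ P` (probability measure), then
`|∫ Π_{j∈P} Z_j dP̄| ≤ L^{|P|}` — AM–GM and linearity; no sup bound on the `Z_j` is needed (print's uncut polynomials
`Ψ′₁, Ψ″₁, Ψ₂` of the Gaussian field have moments of every order, point 2) of Appendix C, but no sup bound).
[cite: BenfattoEtAl1978, (5.29) p.157–158 and Appendix D p.165] -/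
theorem abs_integral_prod_le_of_moments [IsProbabilityMeasure μ] {Z : σ → Ω → ℝ} {L : ℝ} (P : Finset σ)
    (hZm : ∀ j ∈ P, AEStronglyMeasurable (Z j) μ) (hZint : ∀ j ∈ P, Integrable (fun ω => |Z j ω| ^ P.card) μ)
    (hZL : ∀ j ∈ P, ∫ ω, |Z j ω| ^ P.card ∂μ ≤ L ^ P.card) :
    |∫ ω, ∏ j ∈ P, Z j ω ∂μ| ≤ L ^ P.card := by
  rcases P.eq_empty_or_nonempty with rfl | hP
  · simp
  have hn : (0 : ℝ) < P.card := Nat.cast_pos.2 hP.card_pos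
  calc |∫ ω, ∏ j ∈ P, Z j ω ∂μ| ≤ ∫ ω, |∏ j ∈ P, Z j ω| ∂μ := abs_integral_le_integral_abs
    _ ≤ ∫ ω, (∑ j ∈ P, |Z j ω| ^ P.card) / P.card ∂μ := by
        refine integral_mono_of_nonneg (ae_of_all _ fun ω => abs_nonneg _)
          ((integrable_finsetSum P fun j hj => hZint j hj).div_const (P.card : ℝ)) (ae_of_all _ fun ω => ?_)
        dsimp only
        rw [Finset.abs_prod]
        exact prod_le_sum_pow_div hP (fun j => |Z j ω|) fun j _ => abs_nonneg _
    _ = (∑ j ∈ P, ∫ ω, |Z j ω| ^ P.card ∂μ) / P.card := by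
        rw [integral_div, integral_finsetSum P fun j hj => hZint j hj]
    _ ≤ (∑ _j ∈ P, L ^ P.card) / P.card := by
        gcongr with j hj
        exact hZL j hj
    _ = L ^ P.card := by
        rw [Finset.sum_const, nsmul_eq_mul]
        field_simp

end Moments

/-! ## §2  Multilinearity of the joint truncated expectations under moment hypotheses -/

section Multilinear

variable [IsFiniteMeasure μ] {ι : Type*} [Fintype ι]

/-- **Multilinearity of the joint truncated expectations of product moments, MOMENT VERSION** (cf. the bounded version
`B1Eq324BenfattoSect5JointCumulants.ursellOf_moment_sum_eq_sum`): if every `W_{c,j}` has integrable absolute moments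
of all orders `p ≤ |σ|`, the joint truncated expectation of the slots `Σ_c W_{c,j}` is the sum over the colourings
`f : σ → ι` of those of `(W_{f(j),j})_j`. [cite: BenfattoEtAl1978, (2.7) p.147 and (5.25) p.157] -/
theorem ursellOf_moment_sum_eq_sum_of_moments [Nonempty σ] [Nonempty ι] {W : ι → σ → Ω → ℝ}
    (hWm : ∀ c j, AEStronglyMeasurable (W c j) μ)
    (hWint : ∀ c j (p : ℕ), p ≤ Fintype.card σ → Integrable (fun ω => |W c j ω| ^ p) μ) :
    ursellOf (fun P : Finset σ => ∫ ω, ∏ j ∈ P, (∑ c, W c j ω) ∂μ) univ =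
      ∑ f : σ → ι, ursellOf (fun P : Finset σ => ∫ ω, ∏ j ∈ P, W (f j) j ω ∂μ) univ := by
  classical
  set V : Finset (Option σ) := (univ : Finset σ).map Function.Embedding.some with hV
  have hVne : V.Nonempty := by
    obtain ⟨j⟩ := ‹Nonempty σ›
    exact ⟨some j, Finset.mem_map.2 ⟨j, mem_univ _, rfl⟩⟩
  have hsomeV : ∀ j : σ, some j ∈ V := fun j => Finset.mem_map.2 ⟨j, mem_univ _, rfl⟩
  set m : Finset (Option σ) → ℝ :=
    fun P => ∫ ω, ∏ j : σ, (if some j ∈ P then ∑ c, W c j ω else 1) ∂μ with hm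
  set mz : (σ → ι) → Finset (Option σ) → ℝ :=
    fun z P => ∫ ω, ∏ j : σ, (if some j ∈ P then W (z j) j ω else 1) ∂μ with hmz
  have hmem : ∀ (P : Finset σ) (j : σ), (some j ∈ P.map Function.Embedding.some) = (j ∈ P) := fun P j =>
    propext ⟨fun h => by
      obtain ⟨i, hi, hij⟩ := Finset.mem_map.1 h
      rwa [← Option.some_injective _ hij], fun h => Finset.mem_map.2 ⟨j, h, rfl⟩⟩
  -- Step 1: the left side is `ursellOf m V`
  have h1 : ursellOf (fun P : Finset σ => ∫ ω, ∏ j ∈ P, (∑ c, W c j ω) ∂μ) univ = ursellOf m V := by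
    rw [hV, ← ursellOf_map Function.Embedding.some m univ]
    congr 1
    funext P
    simp only [hm]
    refine integral_congr_ae (ae_of_all _ fun ω => ?_)
    dsimp only
    simp_rw [hmem P]
    rw [Finset.prod_ite_mem, Finset.univ_inter]
  -- integrability of the slot products (AM–GM domination)
  obtain ⟨c₁⟩ := ‹Nonempty ι›
  have hint : ∀ (z : σ → ι) (P : Finset (Option σ)),
      Integrable (fun ω => ∏ j : σ, (if some j ∈ P then W (z j) j ω else 1)) μ := by
    intro z P
    have hfun : (fun ω => ∏ j : σ, (if some j ∈ P then W (z j) j ω else 1)) =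
        fun ω => ∏ j ∈ univ.filter (fun j : σ => some j ∈ P), W (z j) j ω := by
      funext ω
      rw [Finset.prod_filter]
    rw [hfun]
    exact integrable_prod_of_moments _ (fun j _ => hWm (z j) j)
      fun j _ => hWint (z j) j _ ((Finset.card_filter_le _ _).trans (Finset.card_univ (α := σ)).le)
  -- Step 2: simultaneous multilinearity over the colourings of the slots
  have h2 : ursellOf m V =
      ∑ z ∈ Fintype.piFinset (colours (fun _ : σ => (univ : Finset ι)) (fun _ => c₁) V),
        ursellOf (mz z) V := by
    refine ursellOf_piFinset (fun _ => univ) (fun _ => c₁) m mz ?_ ?_ hVne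
    · intro P z z' hzz'
      simp only [hmz]
      refine integral_congr_ae (ae_of_all _ fun ω => ?_)
      refine Finset.prod_congr rfl fun j _ => ?_
      by_cases hj : some j ∈ P
      · rw [if_pos hj, if_pos hj, hzz' j hj]
      · rw [if_neg hj, if_neg hj]
    · intro P
      simp only [hm, hmz]
      rw [← integral_finsetSum _ fun z _ => hint z P]
      refine integral_congr_ae (ae_of_all _ fun ω => ?_)
      have key : ∀ j : σ, (if some j ∈ P then ∑ c, W c j ω else 1) =
          ∑ c ∈ colours (fun _ : σ => (univ : Finset ι)) (fun _ => c₁) P j,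
            (if some j ∈ P then W c j ω else 1) := by
        intro j
        by_cases hj : some j ∈ P
        · rw [if_pos hj, colours, if_pos hj]
          simp only [if_pos hj]
        · rw [if_neg hj, colours, if_neg hj, Finset.sum_singleton, if_neg hj]
      dsimp only
      rw [Finset.prod_congr rfl fun j _ => key j, Finset.prod_univ_sum]
  -- Step 3: all slots present ⟹ all colourings
  have h3 : Fintype.piFinset (colours (fun _ : σ => (univ : Finset ι)) (fun _ => c₁) V) = univ := by
    have hc : colours (fun _ : σ => (univ : Finset ι)) (fun _ => c₁) V = fun _ => univ := by
      funext j
      rw [colours, if_pos (hsomeV j)]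
    rw [hc, Fintype.piFinset_univ]
  -- Step 4: back to the slots
  have h4 : ∀ z : σ → ι,
      ursellOf (mz z) V = ursellOf (fun P : Finset σ => ∫ ω, ∏ j ∈ P, W (z j) j ω ∂μ) univ := by
    intro z
    rw [hV, ← ursellOf_map Function.Embedding.some (mz z) univ]
    congr 1
    funext P
    simp only [hmz]
    refine integral_congr_ae (ae_of_all _ fun ω => ?_)
    dsimp only
    simp_rw [hmem P]
    rw [Finset.prod_ite_mem, Finset.univ_inter]
  rw [h1, h2, h3]
  exact Finset.sum_congr rfl fun z _ => h4 z

end Multilinear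

/-! ## §3  (5.29), first term: the replacement of the χ's by 1 — MOMENT form -/

section ChiToOne

variable [IsProbabilityMeasure μ]

omit [Fintype σ] in
/-- The a-priori constant `Σ_{π ∈ 𝒫(V)} (|π| − 1)!` is non-negative. [folklore] -/
private theorem apriori_nonneg' (V : Finset σ) : 0 ≤ ∑ π ∈ setPartitions V, ((π.card - 1)! : ℝ) :=
  Finset.sum_nonneg fun _ _ => Nat.cast_nonneg _

omit [Fintype σ] [DecidableEq σ] [IsProbabilityMeasure μ] in
/-- The marked/unmarked family of the expansion `Z_jχ = Z_j − Z_j(1 − χ)`: `false ↦ Z_j`, `true ↦ −Z_j(1−χ)`.  A product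
over `P` with marking `f` is `(−(1−χ))^{a}·Π_{j∈P} Z_j`, `a` the number of marked slots in `P`. [folklore] -/
private theorem prod_mark_eq {Z : σ → Ω → ℝ} {χ : Ω → ℝ} (f : σ → Bool) (P : Finset σ) (ω : Ω) :
    ∏ j ∈ P, (if f j then -(Z j ω * (1 - χ ω)) else Z j ω) =
      (-(1 - χ ω)) ^ (P.filter fun j => f j = true).card * ∏ j ∈ P, Z j ω := by
  rw [Finset.prod_ite, ← Finset.prod_filter_mul_prod_filter_not P (fun j => f j = true) (fun j => Z j ω)]
  have h1 : ∏ j ∈ P.filter (fun j => f j = true), -(Z j ω * (1 - χ ω)) =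
      (-(1 - χ ω)) ^ (P.filter fun j => f j = true).card * ∏ j ∈ P.filter (fun j => f j = true), Z j ω := by
    rw [← Finset.prod_const, ← Finset.prod_mul_distrib]
    exact Finset.prod_congr rfl fun j _ => by ring
  rw [h1]
  ring

omit [Fintype σ] [DecidableEq σ] in
/-- `(1 − χ)^a ≤ 1_{χ ≠ 1}` for `0 ≤ χ ≤ 1` and `a ≥ 1`; hence `∫ (1−χ)^a dP̄ ≤ P̄(χ ≠ 1)`. [folklore] -/
private theorem integral_one_sub_pow_le {χ : Ω → ℝ} (hχm : Measurable χ) (hχ0 : ∀ ω, 0 ≤ χ ω) (hχ1 : ∀ ω, χ ω ≤ 1)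
    {a : ℕ} (ha : 1 ≤ a) : ∫ ω, (1 - χ ω) ^ a ∂μ ≤ μ.real {ω | χ ω ≠ 1} := by
  have hS : MeasurableSet {ω | χ ω ≠ 1} := (measurableSet_eq_fun hχm measurable_const).compl
  rw [← integral_indicator_one hS]
  refine integral_mono_of_nonneg (ae_of_all _ fun ω => pow_nonneg (sub_nonneg.2 (hχ1 ω)) _)
    ((integrable_const (1 : ℝ)).indicator hS) (ae_of_all _ fun ω => ?_)
  dsimp only
  by_cases hχ : χ ω = 1
  · rw [hχ, sub_self, zero_pow (by omega), Set.indicator_of_notMem (by simpa using hχ)]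
  · rw [Set.indicator_of_mem (by simpa using hχ), Pi.one_apply]
    exact pow_le_one₀ (sub_nonneg.2 (hχ1 ω)) (by linarith [hχ0 ω])

omit [Fintype σ] [DecidableEq σ] in
/-- **A marked joint moment under moment hypotheses**: with `∫|Z_j|^{2|P|} ≤ L^{2|P|}` on `P`, `0 ≤ χ ≤ 1`,
`P̄(χ ≠ 1) ≤ η^{2k}` (`η ≥ 0`) and at least one marked slot in `P`,
`|∫ Π_{j∈P} W_{f(j),j} dP̄| ≤ η^k·L^{|P|}` — Cauchy–Schwarz against the weight `(1−χ)^a ≤ 1_{χ≠1}`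
(`B1Eq324WeightedCumulantLeaf.abs_integral_mul_le_sqrt_mul_sqrt`) and AM–GM for `∫ Π Z_j²` («point 2) and Lemma 1 of
Appendix C» supply these moment and tail inputs for print's Gaussian polynomials).
[cite: BenfattoEtAl1978, (5.29) p.157–158 and Appendix D p.165] -/
theorem abs_integral_prod_mark_le_of_moments {Z : σ → Ω → ℝ} {χ : Ω → ℝ} {L η : ℝ} {k : ℕ}
    (hχm : Measurable χ) (hχ0 : ∀ ω, 0 ≤ χ ω) (hχ1 : ∀ ω, χ ω ≤ 1) (hη0 : 0 ≤ η) (hL : 0 ≤ L)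
    (htail : μ.real {ω | χ ω ≠ 1} ≤ η ^ (2 * k)) (f : σ → Bool) (P : Finset σ)
    (hZm : ∀ j ∈ P, AEStronglyMeasurable (Z j) μ)
    (hZint : ∀ j ∈ P, Integrable (fun ω => |Z j ω| ^ (2 * P.card)) μ)
    (hZL : ∀ j ∈ P, ∫ ω, |Z j ω| ^ (2 * P.card) ∂μ ≤ L ^ (2 * P.card))
    {j₀ : σ} (hj₀ : j₀ ∈ P) (hf : f j₀ = true) :
    |∫ ω, ∏ j ∈ P, (if f j then -(Z j ω * (1 - χ ω)) else Z j ω) ∂μ| ≤ η ^ k * L ^ P.card := by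
  have hP : P.Nonempty := ⟨j₀, hj₀⟩
  set a := (P.filter fun j => f j = true).card with ha_def
  have ha : 1 ≤ a := Finset.card_pos.2 ⟨j₀, Finset.mem_filter.2 ⟨hj₀, hf⟩⟩
  set g : Ω → ℝ := fun ω => ∏ j ∈ P, Z j ω with hg
  -- rewrite the marked product as `(−1)^a (1−χ)^a g`
  have hprod : (fun ω => ∏ j ∈ P, (if f j then -(Z j ω * (1 - χ ω)) else Z j ω)) =
      fun ω => (-1 : ℝ) ^ a * ((1 - χ ω) ^ a * g ω) := by
    funext ω
    rw [prod_mark_eq f P ω, ← ha_def, hg, neg_pow]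
    ring
  -- the square moments of `g`
  have hgm : AEStronglyMeasurable g μ := by
    have h := Finset.aestronglyMeasurable_prod P hZm
    have hfun : (∏ j ∈ P, Z j) = g := by
      funext ω
      simp [hg, Finset.prod_apply]
    rwa [hfun] at h
  have hsq_dom : ∀ ω, g ω ^ 2 ≤ (∑ j ∈ P, |Z j ω| ^ (2 * P.card)) / P.card := by
    intro ω
    have h := prod_le_sum_pow_div hP (fun j => Z j ω ^ 2) fun j _ => sq_nonneg _
    rw [Finset.prod_pow] at h
    refine h.trans_eq ?_
    congr 1
    refine Finset.sum_congr rfl fun j _ => ?_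
    rw [← sq_abs, ← pow_mul]
  have hsum_int : Integrable (fun ω => (∑ j ∈ P, |Z j ω| ^ (2 * P.card)) / P.card) μ :=
    (integrable_finsetSum P fun j hj => hZint j hj).div_const (P.card : ℝ)
  have hg2int : Integrable (fun ω => g ω ^ 2) μ :=
    Integrable.mono' hsum_int (hgm.pow 2) (ae_of_all _ fun ω => by
      rw [Real.norm_eq_abs, abs_of_nonneg (sq_nonneg _)]
      exact hsq_dom ω)
  have hgLp : MemLp g 2 μ := (memLp_two_iff_integrable_sq hgm).2 hg2int
  have hg2 : ∫ ω, g ω ^ 2 ∂μ ≤ L ^ (2 * P.card) := by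
    have hn : (0 : ℝ) < P.card := Nat.cast_pos.2 hP.card_pos
    calc ∫ ω, g ω ^ 2 ∂μ ≤ ∫ ω, (∑ j ∈ P, |Z j ω| ^ (2 * P.card)) / P.card ∂μ :=
          integral_mono_of_nonneg (ae_of_all _ fun ω => sq_nonneg _) hsum_int (ae_of_all _ hsq_dom)
      _ = (∑ j ∈ P, ∫ ω, |Z j ω| ^ (2 * P.card) ∂μ) / P.card := by
          rw [integral_div, integral_finsetSum P fun j hj => hZint j hj]
      _ ≤ (∑ _j ∈ P, L ^ (2 * P.card)) / P.card := by
          gcongr with j hj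
          exact hZL j hj
      _ = L ^ (2 * P.card) := by
          rw [Finset.sum_const, nsmul_eq_mul]
          field_simp
  -- Cauchy–Schwarz against the weight `(1−χ)^a`
  have hw0 : ∀ ω, 0 ≤ (1 - χ ω) ^ a := fun ω => pow_nonneg (sub_nonneg.2 (hχ1 ω)) _
  have hw1 : ∀ ω, (1 - χ ω) ^ a ≤ 1 := fun ω => pow_le_one₀ (sub_nonneg.2 (hχ1 ω)) (by linarith [hχ0 ω])
  have hwm : AEStronglyMeasurable (fun ω => (1 - χ ω) ^ a) μ :=
    ((measurable_const.sub hχm).pow_const a).aestronglyMeasurable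
  have hCS := abs_integral_mul_le_sqrt_mul_sqrt (μ := μ) hwm hw0 hw1 hgLp
  have hw_int := integral_one_sub_pow_le (μ := μ) hχm hχ0 hχ1 ha
  rw [hprod, integral_const_mul, abs_mul, abs_pow, abs_neg, abs_one, one_pow, one_mul]
  calc |∫ ω, (1 - χ ω) ^ a * g ω ∂μ|
      ≤ Real.sqrt (∫ ω, (1 - χ ω) ^ a ∂μ) * Real.sqrt (∫ ω, g ω ^ 2 ∂μ) := hCS
    _ ≤ Real.sqrt (η ^ (2 * k)) * Real.sqrt (L ^ (2 * P.card)) := by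
        gcongr
        · exact hw_int.trans htail
    _ = η ^ k * L ^ P.card := by
        rw [pow_mul', Real.sqrt_sq (pow_nonneg hη0 _), pow_mul', Real.sqrt_sq (pow_nonneg hL _)]

/-- **(5.29), FIRST TERM — «the replacement of the χ's by 1» — MOMENT FORM** (covers print's situation, where the uncut
slots `Ψ′₁, Ψ″₁, Ψ₂` are polynomials of the conditioned Gaussian field: all moments, no sup bound): for slots `Z_j`
with `∫|Z_j|^p dP̄ ≤ L^p` for all `p ≤ 2k` (`k = |σ|`), a weight `0 ≤ χ ≤ 1` and `P̄(χ ≠ 1) ≤ η^{2k}` (`0 ≤ η ≤ 1`),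
`|𝓔^T(Z₁χ,…,Z_kχ) − 𝓔^T(Z₁,…,Z_k)| ≤ 2^k·(Σ_{π∈𝒫(k)}(|π|−1)!)·η·L^k`.  Multilinearity under moment hypotheses
(`ursellOf_moment_sum_eq_sum_of_moments`), the a-priori Ursell bound `B1Eq324BenfattoSect5JointCumulants.abs_ursellOf_le`
with the weight `ηL` on marked slots (`abs_integral_prod_mark_le_of_moments`) and `L` on plain ones
(`abs_integral_prod_le_of_moments`).  AS PROVED vs AS PRINTED: generic rate `η = P̄(χ≠1)^{1/(2k)}` (with (5.19):
`e^{−b²/(8k)}`·poly(b)), print's first term of (5.29) has `e^{−b²/4}` from the Gaussian structure (Appendix D); either is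
absorbed by the `e^{−ρ₃b^{3/2}}` of (4.6)–(4.7). [cite: BenfattoEtAl1978, (5.29) p.157–158 and Appendix D p.165] -/
theorem abs_ursellOf_moment_mul_sub_le_of_moments [Nonempty σ] {Z : σ → Ω → ℝ} {χ : Ω → ℝ} {L η : ℝ}
    (hZm : ∀ j, AEStronglyMeasurable (Z j) μ)
    (hZint : ∀ j (p : ℕ), p ≤ 2 * Fintype.card σ → Integrable (fun ω => |Z j ω| ^ p) μ)
    (hZL : ∀ j (p : ℕ), p ≤ 2 * Fintype.card σ → ∫ ω, |Z j ω| ^ p ∂μ ≤ L ^ p)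
    (hχm : Measurable χ) (hχ0 : ∀ ω, 0 ≤ χ ω) (hχ1 : ∀ ω, χ ω ≤ 1) (hL : 0 ≤ L)
    (hη0 : 0 ≤ η) (hη1 : η ≤ 1) (htail : μ.real {ω | χ ω ≠ 1} ≤ η ^ (2 * Fintype.card σ)) :
    |ursellOf (fun P : Finset σ => ∫ ω, ∏ j ∈ P, Z j ω * χ ω ∂μ) univ -
        ursellOf (fun P : Finset σ => ∫ ω, ∏ j ∈ P, Z j ω ∂μ) univ| ≤
      2 ^ Fintype.card σ *
        ((∑ π ∈ setPartitions (univ : Finset σ), ((π.card - 1)! : ℝ)) * (η * L ^ Fintype.card σ)) := by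
  set k := Fintype.card σ with hk
  -- the two-colour family and its moments
  set W : Bool → σ → Ω → ℝ := fun b j ω => if b then -(Z j ω * (1 - χ ω)) else Z j ω with hW
  have h1χ : ∀ ω, |1 - χ ω| ≤ 1 := fun ω => by
    rw [abs_of_nonneg (sub_nonneg.2 (hχ1 ω))]
    linarith [hχ0 ω]
  have hWm : ∀ b j, AEStronglyMeasurable (W b j) μ := by
    intro b j
    cases b
    · simpa [hW] using hZm j
    · simp only [hW, if_true]
      exact ((hZm j).mul (aestronglyMeasurable_const.sub hχm.aestronglyMeasurable)).neg
  have hWint : ∀ b j (p : ℕ), p ≤ k → Integrable (fun ω => |W b j ω| ^ p) μ := by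
    intro b j p hp
    have hp2 : p ≤ 2 * k := hp.trans (by omega)
    cases b
    · simpa [hW] using hZint j p hp2
    · refine Integrable.mono' (hZint j p hp2) (((hWm true j).norm).pow p |>.congr ?_) (ae_of_all _ fun ω => ?_)
      · exact ae_of_all _ fun ω => by simp [Real.norm_eq_abs]
      · simp only [hW, if_true, Real.norm_eq_abs, abs_pow, abs_abs, abs_neg, abs_mul]
        exact pow_le_pow_left₀ (by positivity) ((mul_le_mul_of_nonneg_left (h1χ ω) (abs_nonneg _)).trans_eq
          (mul_one _)) p
  have hsum : (fun P : Finset σ => ∫ ω, ∏ j ∈ P, Z j ω * χ ω ∂μ) =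
      fun P : Finset σ => ∫ ω, ∏ j ∈ P, (∑ b, W b j ω) ∂μ := by
    funext P
    refine integral_congr_ae (ae_of_all _ fun ω => Finset.prod_congr rfl fun j _ => ?_)
    simp only [hW, Fintype.sum_bool, if_true]
    simp only [Bool.false_eq_true, if_false]
    ring
  rw [hsum, ursellOf_moment_sum_eq_sum_of_moments (W := W) hWm hWint]
  -- split off the unmarked colouring
  set f₀ : σ → Bool := fun _ => false with hf₀
  have hf₀term : ursellOf (fun P : Finset σ => ∫ ω, ∏ j ∈ P, W (f₀ j) j ω ∂μ) univ =
      ursellOf (fun P : Finset σ => ∫ ω, ∏ j ∈ P, Z j ω ∂μ) univ := by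
    simp only [hf₀, hW, Bool.false_eq_true, if_false]
  rw [← Finset.add_sum_erase univ _ (mem_univ f₀), hf₀term, add_sub_cancel_left]
  -- bound the marked colourings
  have hA := apriori_nonneg' (univ : Finset σ)
  have hterm : ∀ f ∈ univ.erase f₀,
      |ursellOf (fun P : Finset σ => ∫ ω, ∏ j ∈ P, W (f j) j ω ∂μ) univ| ≤
        (∑ π ∈ setPartitions (univ : Finset σ), ((π.card - 1)! : ℝ)) * (η * L ^ k) := by
    intro f hf
    obtain ⟨j₀, hj₀⟩ : ∃ j, f j = true := by
      by_contra hno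
      refine (Finset.mem_erase.1 hf).1 (funext fun j => ?_)
      simpa [hf₀] using fun h => hno ⟨j, h⟩
    set Kf : σ → ℝ := fun j => if f j = true then η * L else L with hKf
    have hmom : ∀ P : Finset σ, P ⊆ univ →
        |∫ ω, ∏ j ∈ P, W (f j) j ω ∂μ| ≤ ∏ j ∈ P, Kf j := by
      intro P _
      have hPk : P.card ≤ k := Finset.card_le_univ _
      simp only [hKf]
      rw [Finset.prod_ite, Finset.prod_const, Finset.prod_const]
      set a := (P.filter fun j => f j = true).card with ha_def
      set c := (P.filter fun j => ¬f j = true).card with hc_def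
      have hac : a + c = P.card := by
        rw [ha_def, hc_def, Finset.card_filter_add_card_filter_not]
      by_cases hP : ∃ j ∈ P, f j = true
      · obtain ⟨j, hjP, hjf⟩ := hP
        have ha1 : 1 ≤ a := Finset.card_pos.2 ⟨j, Finset.mem_filter.2 ⟨hjP, hjf⟩⟩
        have hak : a ≤ k := (Finset.card_filter_le _ _).trans hPk
        have hmk := abs_integral_prod_mark_le_of_moments (μ := μ) (k := k) hχm hχ0 hχ1 hη0 hL htail f P
          (fun j _ => hZm j) (fun j _ => hZint j _ (by omega)) (fun j _ => hZL j _ (by omega)) hjP hjf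
        calc |∫ ω, ∏ j ∈ P, W (f j) j ω ∂μ| ≤ η ^ k * L ^ P.card := by simpa [hW] using hmk
          _ ≤ η ^ a * L ^ P.card :=
              mul_le_mul_of_nonneg_right (pow_le_pow_of_le_one hη0 hη1 hak) (pow_nonneg hL _)
          _ = (η * L) ^ a * L ^ c := by rw [mul_pow, ← hac, pow_add]; ring
      · have ha0 : a = 0 := by
          rw [ha_def, Finset.card_eq_zero, Finset.filter_eq_empty_iff]
          exact fun j hj hfj => hP ⟨j, hj, hfj⟩
        have hcP : c = P.card := by omega
        rw [ha0, pow_zero, one_mul, hcP]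
        have hplain : (fun ω => ∏ j ∈ P, W (f j) j ω) = fun ω => ∏ j ∈ P, Z j ω := by
          funext ω
          refine Finset.prod_congr rfl fun j hj => ?_
          have hfj : ¬f j = true := fun h => hP ⟨j, hj, h⟩
          simp only [hW, if_neg hfj]
        rw [hplain]
        exact abs_integral_prod_le_of_moments P (fun j _ => hZm j) (fun j _ => hZint j _ (by omega))
          fun j _ => hZL j _ (by omega)
    have hu := abs_ursellOf_le (fun P : Finset σ => ∫ ω, ∏ j ∈ P, W (f j) j ω ∂μ) (by simp)
      Finset.univ_nonempty Kf hmom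
    refine hu.trans (mul_le_mul_of_nonneg_left ?_ hA)
    simp only [hKf]
    rw [Finset.prod_ite, Finset.prod_const, Finset.prod_const]
    set a := (univ.filter fun j => f j = true).card with ha_def
    set c := (univ.filter fun j => ¬f j = true).card with hc_def
    have hac : a + c = k := by
      rw [ha_def, hc_def, Finset.card_filter_add_card_filter_not]
      rfl
    have ha1 : 1 ≤ a := Finset.card_pos.2 ⟨j₀, by simp [hj₀]⟩
    calc (η * L) ^ a * L ^ c = η ^ a * L ^ k := by rw [mul_pow, ← hac, pow_add]; ring
      _ ≤ η ^ 1 * L ^ k := mul_le_mul_of_nonneg_right (pow_le_pow_of_le_one hη0 hη1 ha1) (pow_nonneg hL _)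
      _ = η * L ^ k := by rw [pow_one]
  refine (Finset.abs_sum_le_sum_abs _ _).trans ((Finset.sum_le_sum hterm).trans ?_)
  rw [Finset.sum_const, nsmul_eq_mul]
  refine mul_le_mul_of_nonneg_right ?_ (mul_nonneg hA (mul_nonneg hη0 (pow_nonneg hL _)))
  calc ((univ.erase f₀).card : ℝ) ≤ ((univ : Finset (σ → Bool)).card : ℝ) := by
        exact_mod_cast Finset.card_erase_le
    _ = 2 ^ k := by
        rw [Finset.card_univ, Fintype.card_fun, Fintype.card_bool]
        push_cast
        rfl

end ChiToOne

end Literature.MathematicalPhysics.QuantumFieldTheory.Balaban1983to89.B1Eq324BenfattoSect5ChiToOne
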